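import Summits.RiemannHypothesis.RiemannHypothesis.Theorems.WeilFormatCFarAssembly
import HarnessLib

/-!
# Format C: L-C3a with a CERTIFIED prime constant — the far diagonal bounds of `gramCoeff a` with `A/2` in place of `A_op⁺/2`

Route context: Fourier–Galerkin / Schur-complement certificates of Weil positivity on a window ("format C";
cell memos `run/shared/lean/pub/rh-explicit/rh-explicit-weil-10/FORMATC-DESIGN.md` §9.9 and
`…/rh-explicit-weil-1/FORMAT-K3.md`; supporting stmt-RiemannHypothesis-0098; seat rh-explicit-weil-1 gen4).

`WeilFormatCFarAssembly.lean` proves the far-diagonal lower bounds of the two sector kernels of `gramCoeff a`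
(`gramCoeff_even_far_ge_diag`, `gramCoeff_odd_far_ge_diag`, `gramCoeff_odd_far_ge_diag_atan`) with the PRIME part bounded
by the path-graph constant `A_op⁺(a) = Σ_{k∈weilPrimeIndex a} Λ(k)k^{−1/2}·2cos(π/(⌊2a/log k⌋+2))` (`primeCoeff_form_ge`),
and every format-C front door in the tree (`weilPositivityOn_of_formatC_data/_dataJ/_kernels`) inherits that constant.
The route-K2/K3 certificates (`WeilFormatC.primeCoeff_form_ge_cells_one_v2`: `A = 2027/1000` on `a ≤ 1`, versus
`A_op⁺(1) = 3.129…`; `…_cells_v2`: `2148/1000` on `a ≤ 10397/10000`; the 6- and 7-term cells) give the SAME inequality with a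
smaller constant.  This file is the far assembly with the prime constant as a PARAMETER:

* hypothesis shape `hPA : ∀ s (c : ℤ → ℂ), −(A·Σ_{n∈s}‖c n‖²) ≤ Σ_{n,m∈s} Re(conj c_n · c_m)·primeCoeff a n m`
  (literally the statement of `primeCoeff_form_ge_cells_one_v2` & co., and of `primeCoeff_form_ge` for `A = A_op⁺`);
  `primeCoeff_form_ge_real_of` — its real-coefficient form;
* `gramCoeff_even_far_ge_diag_A`, `gramCoeff_odd_far_ge_diag_A`, `gramCoeff_odd_far_ge_diag_atan_A` — the three far bounds
  of `WeilFormatCFarAssembly.lean` VERBATIM with `A / 2` replacing `A_op⁺/2` in the far diagonals `d̂⁺`, `d̂⁻`, under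
  `hPA`.

Consumed by the parametrised front door `weilPositivityOn_of_formatC_kernelsA` (`WeilFormatCDataRungGenericA.lean`).
Standard axioms; no definitions; no RH claim.
-/

set_option autoImplicit false
-- `Summit.RiemannHypothesis.RiemannHypothesis.…` is the layout-mandated namespace (summit = problem name).
set_option linter.dupNamespace false

noncomputable section

open Complex Finset
open scoped Real BigOperators ComplexConjugate ArithmeticFunction.vonMangoldt

namespace Summit.RiemannHypothesis.RiemannHypothesis.Theorems.WeilFormatC

open Literature.NumberTheory.LFunctions Literature.NumberTheory.LFunctions.Yoshida1992
open Literature.Analysis.SpecialFunctions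

variable {a : ℝ}

/-! ## Real-coefficient form of a certified prime constant -/

/-- Real-coefficient form of a certified prime constant: `−A·Σ x_n² ≤ Σ x_n x_m primeCoeff a n m`. [folklore] -/
theorem primeCoeff_form_ge_real_of {A : ℝ}
    (hPA : ∀ (s : Finset ℤ) (c : ℤ → ℂ),
      -(A * ∑ n ∈ s, ‖c n‖ ^ 2) ≤ ∑ n ∈ s, ∑ m ∈ s, (conj (c n) * c m).re * primeCoeff a n m)
    (s : Finset ℤ) (x : ℤ → ℝ) :
    -(A * ∑ n ∈ s, x n ^ 2) ≤ ∑ n ∈ s, ∑ m ∈ s, x n * x m * primeCoeff a n m := by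
  have h := hPA s (fun n ↦ ((x n : ℝ) : ℂ))
  have e1 : ∑ n ∈ s, ‖((x n : ℝ) : ℂ)‖ ^ 2 = ∑ n ∈ s, x n ^ 2 :=
    Finset.sum_congr rfl fun n _ ↦ by rw [Complex.norm_real, Real.norm_eq_abs, sq_abs]
  have e2 : ∑ n ∈ s, ∑ m ∈ s, (conj ((x n : ℝ) : ℂ) * ((x m : ℝ) : ℂ)).re * primeCoeff a n m
      = ∑ n ∈ s, ∑ m ∈ s, x n * x m * primeCoeff a n m :=
    Finset.sum_congr rfl fun n _ ↦ Finset.sum_congr rfl fun m _ ↦ by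
      rw [Complex.conj_ofReal, ← Complex.ofReal_mul, Complex.ofReal_re]
  rw [e1, e2] at h
  exact h

/-! ## The far diagonal bounds for `gramCoeff` with the constant `A` -/

section Far

/-- **L-C3a with a CERTIFIED prime constant `A`, even sector.**  For `a > 0`, a certified prime constant `A` (`hPA`), `2 ≤ B` and every `N`, `y`:
`Σ_{n∈Ico B N} d̂⁺(n) y_n² ≤ Σ_{n,m∈Ico B N} y_n M⁺_{gramCoeff a}(n,m) y_m` (module docstring for `d̂⁺_A`). [folklore] -/
theorem gramCoeff_even_far_ge_diag_A (ha : 0 < a) {A : ℝ}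
    (hPA : ∀ (s : Finset ℤ) (c : ℤ → ℂ),
      -(A * ∑ n ∈ s, ‖c n‖ ^ 2) ≤ ∑ n ∈ s, ∑ m ∈ s, (conj (c n) * c m).re * primeCoeff a n m)
    {B : ℕ} (hB : 2 ≤ B) (N : ℕ) (y : ℕ → ℝ) :
    ∑ n ∈ Finset.Ico B N,
        ((reDigammaQuarter (freq a n) - Real.log π) / 2 - a * (1 + weilArchDensity (2 * a)) / (π ^ 2 * n ^ 2)
          - 1 / (8 * n) - a * (1 + weilArchDensity (2 * a)) / π ^ 2 * Real.sqrt (8 / ((B - 1 : ℕ) : ℝ))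
          - A / 2)
          * y n ^ 2
      ≤ ∑ n ∈ Finset.Ico B N, ∑ m ∈ Finset.Ico B N,
          y n * (if n = 0 then gramCoeff a 0 m else if m = 0 then gramCoeff a n 0
            else (gramCoeff a n m + gramCoeff a n (-(m : ℤ))) / 2) * y m := by
  have hB1 : 1 ≤ B := le_trans (by norm_num) hB
  have hs1 : ∀ n ∈ Finset.Ico B N, 1 ≤ n := fun n hn ↦ le_trans hB1 (Finset.mem_Ico.mp hn).1
  -- split the kernel
  have hsplit : ∀ n ∈ Finset.Ico B N, ∀ m ∈ Finset.Ico B N,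
      y n * (if n = 0 then gramCoeff a 0 m else if m = 0 then gramCoeff a n 0
            else (gramCoeff a n m + gramCoeff a n (-(m : ℤ))) / 2) * y m
        = y n * (if n = 0 then polarCoeff a 0 m else if m = 0 then polarCoeff a n 0
            else (polarCoeff a n m + polarCoeff a n (-(m : ℤ))) / 2) * y m
          + y n * (if n = 0 then primeCoeff a 0 m else if m = 0 then primeCoeff a n 0
            else (primeCoeff a n m + primeCoeff a n (-(m : ℤ))) / 2) * y m
          + y n * ((archCoeff a n m + archCoeff a n (-(m : ℤ))) / 2) * y m := by
    intro n hn m hm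
    rw [evenKernel_of_pos _ (hs1 n hn) (hs1 m hm), evenKernel_of_pos _ (hs1 n hn) (hs1 m hm),
      evenKernel_of_pos _ (hs1 n hn) (hs1 m hm)]
    unfold gramCoeff
    ring
  have hform : ∑ n ∈ Finset.Ico B N, ∑ m ∈ Finset.Ico B N,
      y n * (if n = 0 then gramCoeff a 0 m else if m = 0 then gramCoeff a n 0
            else (gramCoeff a n m + gramCoeff a n (-(m : ℤ))) / 2) * y m
      = (∑ n ∈ Finset.Ico B N, ∑ m ∈ Finset.Ico B N,
          y n * (if n = 0 then polarCoeff a 0 m else if m = 0 then polarCoeff a n 0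
            else (polarCoeff a n m + polarCoeff a n (-(m : ℤ))) / 2) * y m)
        + (∑ n ∈ Finset.Ico B N, ∑ m ∈ Finset.Ico B N,
          y n * (if n = 0 then primeCoeff a 0 m else if m = 0 then primeCoeff a n 0
            else (primeCoeff a n m + primeCoeff a n (-(m : ℤ))) / 2) * y m)
        + ∑ n ∈ Finset.Ico B N, ∑ m ∈ Finset.Ico B N,
          y n * ((archCoeff a n m + archCoeff a n (-(m : ℤ))) / 2) * y m := by
    rw [← Finset.sum_add_distrib, ← Finset.sum_add_distrib]
    refine Finset.sum_congr rfl fun n hn ↦ ?_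
    rw [← Finset.sum_add_distrib, ← Finset.sum_add_distrib]
    exact Finset.sum_congr rfl fun m hm ↦ hsplit n hn m hm
  -- POLAR ⪰ 0
  have hpol := even_far_lower_const_of_modes (polarCoeff a) (polarCoeff_neg_neg a) hB1 (N := N) 0
    (fun x hx _ ↦ by rw [zero_mul]; exact polarCoeff_form_nonneg_of_even ha N x hx) y
  -- PRIME ⪰ −A/2 (the certified constant)
  have hpri := even_far_lower_const_of_modes (primeCoeff a) (primeCoeff_neg_neg a) hB1 (N := N) (-A)
    (fun x _ _ ↦ by
      have h := primeCoeff_form_ge_real_of hPA (modes N) x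
      linarith) y
  -- ARCH ⪰ diag(e⁺) with M₁ = B − 1
  have harch := evenArch_far_ge_diag ha (M₁ := B - 1) (by omega) (N - 1) y
  rw [← Ico_eq_Ioc_pred hB1 N] at harch
  -- assemble
  rw [hform]
  have hlhs : ∑ n ∈ Finset.Ico B N,
      ((reDigammaQuarter (freq a n) - Real.log π) / 2 - a * (1 + weilArchDensity (2 * a)) / (π ^ 2 * n ^ 2)
        - 1 / (8 * n) - a * (1 + weilArchDensity (2 * a)) / π ^ 2 * Real.sqrt (8 / ((B - 1 : ℕ) : ℝ))
        - A / 2) * y n ^ 2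
      = 0 / 2 * ∑ n ∈ Finset.Ico B N, y n ^ 2 + (-A) / 2 * ∑ n ∈ Finset.Ico B N, y n ^ 2
        + ∑ n ∈ Finset.Ico B N,
          ((reDigammaQuarter (freq a n) - Real.log π) / 2 - a * (1 + weilArchDensity (2 * a)) / (π ^ 2 * n ^ 2)
            - 1 / (8 * n) - a * (1 + weilArchDensity (2 * a)) / π ^ 2 * Real.sqrt (8 / ((B - 1 : ℕ) : ℝ)))
            * y n ^ 2 := by
    rw [zero_div, zero_mul, zero_add, Finset.mul_sum, ← Finset.sum_add_distrib]
    refine Finset.sum_congr rfl fun n _ ↦ by ring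
  rw [hlhs]
  exact add_le_add (add_le_add hpol hpri) harch

/-- **L-C3a with a CERTIFIED prime constant `A`, odd sector.**  For `a > 0`, a certified prime constant `A` (`hPA`), `1 ≤ B` and every `N`, `z` (kernel index `k` = mode `k+1`):
`Σ_{k∈Ico B N} d̂⁻(k) z_k² ≤ Σ_{k,l∈Ico B N} z_k M⁻_{gramCoeff a}(k,l) z_l` (module docstring for `d̂⁻_A`). [folklore] -/
theorem gramCoeff_odd_far_ge_diag_A (ha : 0 < a) {A : ℝ}
    (hPA : ∀ (s : Finset ℤ) (c : ℤ → ℂ),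
      -(A * ∑ n ∈ s, ‖c n‖ ^ 2) ≤ ∑ n ∈ s, ∑ m ∈ s, (conj (c n) * c m).re * primeCoeff a n m)
    {B : ℕ} (hB : 1 ≤ B) (N : ℕ) (z : ℕ → ℝ) :
    ∑ k ∈ Finset.Ico B N,
        ((reDigammaQuarter (freq a ((k : ℤ) + 1)) - Real.log π) / 2 - 1 / (8 * ((k : ℝ) + 1))
          - a * (1 + weilArchDensity (2 * a)) / (π ^ 2 * ((k : ℝ) + 1) ^ 2)
          - Real.log ((((k : ℝ) + 1) + B) / B) / 4
          - a * (1 + weilArchDensity (2 * a)) / π ^ 2 * Real.sqrt (8 / B)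
          - A / 2
          - (Real.exp (a / 2) - Real.exp (-(a / 2))) ^ 2 * a / (π ^ 2 * B))
          * z k ^ 2
      ≤ ∑ k ∈ Finset.Ico B N, ∑ l ∈ Finset.Ico B N,
          z k * ((gramCoeff a ((k : ℤ) + 1) ((l : ℤ) + 1) - gramCoeff a ((k : ℤ) + 1) (-((l : ℤ) + 1))) / 2) * z l := by
  set S2 := (Real.exp (a / 2) - Real.exp (-(a / 2))) ^ 2 with hS2
  -- split the kernel
  have hform : ∑ k ∈ Finset.Ico B N, ∑ l ∈ Finset.Ico B N,
      z k * ((gramCoeff a ((k : ℤ) + 1) ((l : ℤ) + 1) - gramCoeff a ((k : ℤ) + 1) (-((l : ℤ) + 1))) / 2) * z l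
      = (∑ k ∈ Finset.Ico B N, ∑ l ∈ Finset.Ico B N,
          z k * ((polarCoeff a ((k : ℤ) + 1) ((l : ℤ) + 1) - polarCoeff a ((k : ℤ) + 1) (-((l : ℤ) + 1))) / 2) * z l)
        + (∑ k ∈ Finset.Ico B N, ∑ l ∈ Finset.Ico B N,
          z k * ((primeCoeff a ((k : ℤ) + 1) ((l : ℤ) + 1) - primeCoeff a ((k : ℤ) + 1) (-((l : ℤ) + 1))) / 2) * z l)
        + ∑ k ∈ Finset.Ico B N, ∑ l ∈ Finset.Ico B N,
          z k * ((archCoeff a ((k : ℤ) + 1) ((l : ℤ) + 1) - archCoeff a ((k : ℤ) + 1) (-((l : ℤ) + 1))) / 2) * z l := by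
    rw [← Finset.sum_add_distrib, ← Finset.sum_add_distrib]
    refine Finset.sum_congr rfl fun k _ ↦ ?_
    rw [← Finset.sum_add_distrib, ← Finset.sum_add_distrib]
    refine Finset.sum_congr rfl fun l _ ↦ ?_
    unfold gramCoeff
    ring
  -- POLAR ⪰ −s²a/(π²B)
  have hpol := odd_far_lower_const_of_modes (polarCoeff a) (polarCoeff_neg_neg a) (B := B) (N := N)
    (-(2 * S2 * a / (π ^ 2 * B)))
    (fun x hx hs ↦ by
      have h := polarCoeff_form_ge_of_odd ha hB N x hx (fun p hp ↦ hs p (Or.inl hp))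
      rw [← hS2] at h
      exact h) z
  -- PRIME ⪰ −A/2 (the certified constant)
  have hpri := odd_far_lower_const_of_modes (primeCoeff a) (primeCoeff_neg_neg a) (B := B) (N := N) (-A)
    (fun x _ _ ↦ by
      have h := primeCoeff_form_ge_real_of hPA (modes N) x
      linarith) z
  -- ARCH ⪰ diag(e⁻) with M₁ = B, modes n = k + 1
  have harch := oddArch_far_ge_diag ha (M₁ := B) hB N (fun n ↦ z (n - 1))
  rw [← sum_Ico_succ_eq_sum_Ioc B N, ← sum_Ico_succ_eq_sum_Ioc B N] at harch
  simp only [Nat.add_sub_cancel] at harch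
  have harch' : ∑ k ∈ Finset.Ico B N,
      ((reDigammaQuarter (freq a ((k : ℤ) + 1)) - Real.log π) / 2 - 1 / (8 * ((k : ℝ) + 1))
        - a * (1 + weilArchDensity (2 * a)) / (π ^ 2 * ((k : ℝ) + 1) ^ 2)
        - Real.log ((((k : ℝ) + 1) + B) / B) / 4
        - a * (1 + weilArchDensity (2 * a)) / π ^ 2 * Real.sqrt (8 / B)) * z k ^ 2
      ≤ ∑ k ∈ Finset.Ico B N, ∑ l ∈ Finset.Ico B N,
          z k * ((archCoeff a ((k : ℤ) + 1) ((l : ℤ) + 1) - archCoeff a ((k : ℤ) + 1) (-((l : ℤ) + 1))) / 2) * z l := by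
    refine le_of_eq_of_le ?_ (harch.trans (le_of_eq ?_))
    · refine Finset.sum_congr rfl fun k _ ↦ ?_
      push_cast
      ring
    · refine Finset.sum_congr rfl fun k _ ↦ ?_
      rw [← sum_Ico_succ_eq_sum_Ioc B N]
      refine Finset.sum_congr rfl fun l _ ↦ ?_
      simp only [Nat.add_sub_cancel]
      push_cast
      ring
  -- assemble
  rw [hform]
  have hlhs : ∑ k ∈ Finset.Ico B N,
      ((reDigammaQuarter (freq a ((k : ℤ) + 1)) - Real.log π) / 2 - 1 / (8 * ((k : ℝ) + 1))
        - a * (1 + weilArchDensity (2 * a)) / (π ^ 2 * ((k : ℝ) + 1) ^ 2)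
        - Real.log ((((k : ℝ) + 1) + B) / B) / 4
        - a * (1 + weilArchDensity (2 * a)) / π ^ 2 * Real.sqrt (8 / B)
        - A / 2 - S2 * a / (π ^ 2 * B)) * z k ^ 2
      = (-(2 * S2 * a / (π ^ 2 * B))) / 2 * ∑ k ∈ Finset.Ico B N, z k ^ 2
        + (-A) / 2 * ∑ k ∈ Finset.Ico B N, z k ^ 2
        + ∑ k ∈ Finset.Ico B N,
          ((reDigammaQuarter (freq a ((k : ℤ) + 1)) - Real.log π) / 2 - 1 / (8 * ((k : ℝ) + 1))
            - a * (1 + weilArchDensity (2 * a)) / (π ^ 2 * ((k : ℝ) + 1) ^ 2)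
            - Real.log ((((k : ℝ) + 1) + B) / B) / 4
            - a * (1 + weilArchDensity (2 * a)) / π ^ 2 * Real.sqrt (8 / B)) * z k ^ 2 := by
    rw [Finset.mul_sum, Finset.mul_sum, ← Finset.sum_add_distrib, ← Finset.sum_add_distrib]
    refine Finset.sum_congr rfl fun k _ ↦ by ring
  rw [hlhs]
  exact add_le_add (add_le_add hpol hpri) harch'

/-- **L-C3a with a CERTIFIED prime constant `A`, odd sector, arctan Hilbert weights** (the DATA pipeline's default far bound; bounded penalty
`½(π/2 − arctan(√B/√(k+1))) ≤ π/4`, convenient for the positivity check `0 < d̂`).  For `a > 0`, `1 ≤ B` and every `N`, `z` (kernel index `k` = mode `k+1`):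
`Σ_{k∈Ico B N} d̂⁻(k) z_k² ≤ Σ_{k,l∈Ico B N} z_k M⁻_{gramCoeff a}(k,l) z_l` (with `¼log((k+1+B)/B)` replaced by `½(π/2 − arctan(√B/√(k+1)))` in `d̂⁻_A`). [folklore] -/
theorem gramCoeff_odd_far_ge_diag_atan_A (ha : 0 < a) {A : ℝ}
    (hPA : ∀ (s : Finset ℤ) (c : ℤ → ℂ),
      -(A * ∑ n ∈ s, ‖c n‖ ^ 2) ≤ ∑ n ∈ s, ∑ m ∈ s, (conj (c n) * c m).re * primeCoeff a n m)
    {B : ℕ} (hB : 1 ≤ B) (N : ℕ) (z : ℕ → ℝ) :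
    ∑ k ∈ Finset.Ico B N,
        ((reDigammaQuarter (freq a ((k : ℤ) + 1)) - Real.log π) / 2 - 1 / (8 * ((k : ℝ) + 1))
          - a * (1 + weilArchDensity (2 * a)) / (π ^ 2 * ((k : ℝ) + 1) ^ 2)
          - (π / 2 - Real.arctan (Real.sqrt B / Real.sqrt ((k : ℝ) + 1))) / 2
          - a * (1 + weilArchDensity (2 * a)) / π ^ 2 * Real.sqrt (8 / B)
          - A / 2
          - (Real.exp (a / 2) - Real.exp (-(a / 2))) ^ 2 * a / (π ^ 2 * B))
          * z k ^ 2
      ≤ ∑ k ∈ Finset.Ico B N, ∑ l ∈ Finset.Ico B N,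
          z k * ((gramCoeff a ((k : ℤ) + 1) ((l : ℤ) + 1) - gramCoeff a ((k : ℤ) + 1) (-((l : ℤ) + 1))) / 2) * z l := by
  set S2 := (Real.exp (a / 2) - Real.exp (-(a / 2))) ^ 2 with hS2
  -- split the kernel
  have hform : ∑ k ∈ Finset.Ico B N, ∑ l ∈ Finset.Ico B N,
      z k * ((gramCoeff a ((k : ℤ) + 1) ((l : ℤ) + 1) - gramCoeff a ((k : ℤ) + 1) (-((l : ℤ) + 1))) / 2) * z l
      = (∑ k ∈ Finset.Ico B N, ∑ l ∈ Finset.Ico B N,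
          z k * ((polarCoeff a ((k : ℤ) + 1) ((l : ℤ) + 1) - polarCoeff a ((k : ℤ) + 1) (-((l : ℤ) + 1))) / 2) * z l)
        + (∑ k ∈ Finset.Ico B N, ∑ l ∈ Finset.Ico B N,
          z k * ((primeCoeff a ((k : ℤ) + 1) ((l : ℤ) + 1) - primeCoeff a ((k : ℤ) + 1) (-((l : ℤ) + 1))) / 2) * z l)
        + ∑ k ∈ Finset.Ico B N, ∑ l ∈ Finset.Ico B N,
          z k * ((archCoeff a ((k : ℤ) + 1) ((l : ℤ) + 1) - archCoeff a ((k : ℤ) + 1) (-((l : ℤ) + 1))) / 2) * z l := by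
    rw [← Finset.sum_add_distrib, ← Finset.sum_add_distrib]
    refine Finset.sum_congr rfl fun k _ ↦ ?_
    rw [← Finset.sum_add_distrib, ← Finset.sum_add_distrib]
    refine Finset.sum_congr rfl fun l _ ↦ ?_
    unfold gramCoeff
    ring
  -- POLAR ⪰ −s²a/(π²B)
  have hpol := odd_far_lower_const_of_modes (polarCoeff a) (polarCoeff_neg_neg a) (B := B) (N := N)
    (-(2 * S2 * a / (π ^ 2 * B)))
    (fun x hx hs ↦ by
      have h := polarCoeff_form_ge_of_odd ha hB N x hx (fun p hp ↦ hs p (Or.inl hp))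
      rw [← hS2] at h
      exact h) z
  -- PRIME ⪰ −A/2 (the certified constant)
  have hpri := odd_far_lower_const_of_modes (primeCoeff a) (primeCoeff_neg_neg a) (B := B) (N := N) (-A)
    (fun x _ _ ↦ by
      have h := primeCoeff_form_ge_real_of hPA (modes N) x
      linarith) z
  -- ARCH ⪰ diag(e⁻) with M₁ = B, modes n = k + 1
  have harch := oddArch_far_ge_diag_atan ha (M₁ := B) hB N (fun n ↦ z (n - 1))
  rw [← sum_Ico_succ_eq_sum_Ioc B N, ← sum_Ico_succ_eq_sum_Ioc B N] at harch
  simp only [Nat.add_sub_cancel] at harch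
  have harch' : ∑ k ∈ Finset.Ico B N,
      ((reDigammaQuarter (freq a ((k : ℤ) + 1)) - Real.log π) / 2 - 1 / (8 * ((k : ℝ) + 1))
        - a * (1 + weilArchDensity (2 * a)) / (π ^ 2 * ((k : ℝ) + 1) ^ 2)
        - (π / 2 - Real.arctan (Real.sqrt B / Real.sqrt ((k : ℝ) + 1))) / 2
        - a * (1 + weilArchDensity (2 * a)) / π ^ 2 * Real.sqrt (8 / B)) * z k ^ 2
      ≤ ∑ k ∈ Finset.Ico B N, ∑ l ∈ Finset.Ico B N,
          z k * ((archCoeff a ((k : ℤ) + 1) ((l : ℤ) + 1) - archCoeff a ((k : ℤ) + 1) (-((l : ℤ) + 1))) / 2) * z l := by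
    refine le_of_eq_of_le ?_ (harch.trans (le_of_eq ?_))
    · refine Finset.sum_congr rfl fun k _ ↦ ?_
      push_cast
      ring
    · refine Finset.sum_congr rfl fun k _ ↦ ?_
      rw [← sum_Ico_succ_eq_sum_Ioc B N]
      refine Finset.sum_congr rfl fun l _ ↦ ?_
      simp only [Nat.add_sub_cancel]
      push_cast
      ring
  -- assemble
  rw [hform]
  have hlhs : ∑ k ∈ Finset.Ico B N,
      ((reDigammaQuarter (freq a ((k : ℤ) + 1)) - Real.log π) / 2 - 1 / (8 * ((k : ℝ) + 1))
        - a * (1 + weilArchDensity (2 * a)) / (π ^ 2 * ((k : ℝ) + 1) ^ 2)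
        - (π / 2 - Real.arctan (Real.sqrt B / Real.sqrt ((k : ℝ) + 1))) / 2
        - a * (1 + weilArchDensity (2 * a)) / π ^ 2 * Real.sqrt (8 / B)
        - A / 2 - S2 * a / (π ^ 2 * B)) * z k ^ 2
      = (-(2 * S2 * a / (π ^ 2 * B))) / 2 * ∑ k ∈ Finset.Ico B N, z k ^ 2
        + (-A) / 2 * ∑ k ∈ Finset.Ico B N, z k ^ 2
        + ∑ k ∈ Finset.Ico B N,
          ((reDigammaQuarter (freq a ((k : ℤ) + 1)) - Real.log π) / 2 - 1 / (8 * ((k : ℝ) + 1))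
            - a * (1 + weilArchDensity (2 * a)) / (π ^ 2 * ((k : ℝ) + 1) ^ 2)
            - (π / 2 - Real.arctan (Real.sqrt B / Real.sqrt ((k : ℝ) + 1))) / 2
            - a * (1 + weilArchDensity (2 * a)) / π ^ 2 * Real.sqrt (8 / B)) * z k ^ 2 := by
    rw [Finset.mul_sum, Finset.mul_sum, ← Finset.sum_add_distrib, ← Finset.sum_add_distrib]
    refine Finset.sum_congr rfl fun k _ ↦ by ring
  rw [hlhs]
  exact add_le_add (add_le_add hpol hpri) harch'

end Far

end Summit.RiemannHypothesis.RiemannHypothesis.Theorems.WeilFormatC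

end
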